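import Summits.CriticalPhenomena.CardyFormulaZ2.Theorems.CardyBoundaryCoulombGasBoundaryDefectGaussianRStubRealisabilityPart14
import Summits.CriticalPhenomena.CardyFormulaZ2.Theorems.CardyBoundaryCoulombGasBoundaryDefectGaussianRStubRealisabilityPart19
import Summits.CriticalPhenomena.CardyFormulaZ2.Theorems.CardyBoundaryCoulombGasBoundaryDefectGaussianRStubRealisabilityPart10

/-!
# Stub `s17_dictionary_of` of line `rainbow-monomials-in-excursion-kernels` — Part 1:
# the per-configuration sum over heights as an abstract Baxter–Kelland–Wu strand sum
# (crux `BoundaryDefectGaussianR`, stmt-CriticalPhenomena-14132; insertion dictionary D2, count assembly)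

First of three files assembling the COUNT `‖Zins V ι‖ = #{ω ⊆ E : Rainbow}` of the insertion
dictionary of `Literature.Probability.LatticeModels.CollarLegModel` from the landed layers. For a
GENERAL collar leg model `M` and a set `ω` of live edges (meant: `ω ⊆ M.E`), write
`σ = nextCorner (M.cfgOf ω)` for the turning rule, `C = cornerSet (piece M)` for the corners over the
piece and `B = {c ∈ C | IsCut c}` for the cut corners. This file proves:

* `nextCorner_cfgOf_mem_cornerSet_iff` — for `ω ⊆ E` the turning rule maps `C` to itself (both
  endpoints of every edge of the completed configuration are vertex-cells), so `σ` restricts to a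
  permutation of `↥C`;
* `dict_prod_turnFactor_eq` — the per-configuration factor of Part 14 with its cut set identified
  with `B` by the frozen consistency transfer (Lemma C, hypothesis `hC`):
  `∏_c turnFactor h (cfgOf ω) c = 𝟙[bit h is σ-invariant off B] · ∏_c exp(i ε(bit h c) g c)`,
  `g = (π/12) turnSign (cfgOf ω)` off `B`, `0` on `B`;
* `dict_sum_eq_zero_of_inconsistent` / `dict_live_consistent_of_invariant` — the sum over the
  height configurations vanishes unless some valid `h` has all its live turns consistent;
* `dict_bit_injOn` — the change of variables `h ↦ bit h|_C` is injective on the valid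
  configurations (unit differences + heights from arrows, Part 10); `dict_image_bit_eq` — its image,
  restricted to the `σ`-invariant-off-`B` configurations, is the set of consistent arrow
  configurations with the forced bits `bit h₀` on `B`, GIVEN the heights-existence statement `H5ω`
  for this `ω` and the forced-bits statement `hforced` as hypotheses;
* `dict_sum_configs_eq_sum_consistent` — hence `Σ_{h ∈ configs} ∏_c turnFactor h (cfgOf ω) c` is the
  left-hand side of the abstract strand expansion `bkwStrand_sum_consistent_forced` (Part 5) for the
  restricted permutation, the cut set `B`, the forced bits `bit h₀` and the phases `g`.

Registered sub-goal carried here: `s17_dictionary_of_part1` (the last identity, permutation-free form).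
-/

namespace Summit.CriticalPhenomena.CardyFormulaZ2.Cruxes.BoundaryDefectGaussianR.RainbowMonomialsInExcursionKernels

open Finset Literature.Probability.LatticeModels Literature.Probability.LatticeModels.CollarLegModel
open Literature.Probability.Percolation

/-! ### The corners over the piece are invariant under the turning rule -/

section CornerSet

variable (M : CollarLegModel)

/-- Both endpoints of a frozen open edge (spoke, ghost edge, pocket edge) are vertex-cells. [folklore] -/
theorem dict_openEdges_endpoints {e : (ℤ × ℤ) × Bool} (he : e ∈ M.openEdges) :
    e.1 ∈ M.vertexCells ∧ SixVertex.edgeTip e ∈ M.vertexCells := by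
  rw [openEdges, mem_filter] at he
  rcases he.2 with ⟨h1, h2⟩ | ⟨h1, h2⟩ | ⟨h1, h2, p, hp, hep⟩
  · exact ⟨mem_union_left _ (mem_inter.1 h1).2, mem_union_right _ h2⟩
  · exact ⟨mem_union_right _ h2, mem_union_left _ (mem_inter.1 h1).2⟩
  · have hc : e.1 ∈ SixVertex.faceCorners p ∧ SixVertex.edgeTip e ∈ SixVertex.faceCorners p := by
      simp only [faceEdges, mem_insert, mem_singleton] at hep
      rcases hep with rfl | rfl | rfl | rfl <;> simp [SixVertex.faceCorners, SixVertex.edgeTip]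
    exact ⟨mem_union_right _ (mem_sdiff.2 ⟨mem_union_right _ (mem_biUnion.2 ⟨p, hp, hc.1⟩), h1⟩),
      mem_union_right _ (mem_sdiff.2 ⟨mem_union_right _ (mem_biUnion.2 ⟨p, hp, hc.2⟩), h2⟩)⟩

/-- A site lies in the piece iff it is a vertex-cell (`toSite ∘ ofSite = id`). [folklore] -/
theorem dict_mem_piece_iff {x : Site 2} : x ∈ M.piece ↔ ofSite x ∈ M.vertexCells := by
  rw [piece, mem_image]
  constructor
  · rintro ⟨v, hv, rfl⟩; rwa [ofSite_toSite]
  · exact fun h => ⟨ofSite x, h, by funext i; fin_cases i <;> simp [toSite, ofSite]⟩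

/-- Both endpoints of an edge of the completed configuration of `ω ⊆ E` are vertex-cells (a live
edge has its endpoints in `V`, a frozen open one in the vertex-cells). [folklore] -/
theorem dict_endpoints_of_mem_cfgOf {ω : Finset ((ℤ × ℤ) × Bool)} (hω : ω ⊆ M.E) {c : Site 2 × Fin 4}
    (hc : cTgt c ∈ M.cfgOf ω) :
    ofSite c.1 ∈ M.vertexCells ∧ ofSite (c.1 + cornerUnit (c.2 + 1)) ∈ M.vertexCells := by
  rw [cfgOf, Finset.mem_coe, mem_image] at hc
  obtain ⟨e, he, hce⟩ := hc
  have hends : e.1 ∈ M.vertexCells ∧ SixVertex.edgeTip e ∈ M.vertexCells := by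
    rcases mem_union.1 he with he | he
    · have := hω he
      rw [E, inducedEdges, mem_filter] at this
      exact ⟨M.mem_vertexCells_of_mem this.2.1, M.mem_vertexCells_of_mem this.2.2⟩
    · exact dict_openEdges_endpoints M he
  rw [edgeSym2, cTgt, Sym2.eq_iff] at hce
  rcases hce with ⟨h1, h2⟩ | ⟨h1, h2⟩
  · rw [← h2, ← h1, ofSite_toSite, ofSite_toSite]; exact hends
  · rw [← h1, ← h2, ofSite_toSite, ofSite_toSite]; exact ⟨hends.2, hends.1⟩

/-- **The corners over the piece are invariant under the turning rule of `cfgOf ω`, `ω ⊆ E`**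
(following an open edge keeps the vertex among the vertex-cells, crossing a closed one keeps the
vertex). [cite: BaxterKellandWu1976, §3] -/
theorem nextCorner_cfgOf_mem_cornerSet_iff {ω : Finset ((ℤ × ℤ) × Bool)} (hω : ω ⊆ M.E) (c : Site 2 × Fin 4) :
    nextCorner (M.cfgOf ω) c ∈ cornerSet M.piece ↔ c ∈ cornerSet M.piece := by
  rw [mem_cornerSet, mem_cornerSet, dict_mem_piece_iff, dict_mem_piece_iff]
  by_cases hb : cTgt c ∈ M.cfgOf ω
  · rw [nextCorner_of_mem hb]
    have h := dict_endpoints_of_mem_cfgOf M hω hb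
    exact ⟨fun _ => h.1, fun _ => h.2⟩
  · rw [nextCorner_of_not_mem hb]

end CornerSet

/-! ### The per-configuration factor with the cut set; vanishing -/

section PerConfiguration

variable {M : CollarLegModel} {ω : Finset ((ℤ × ℤ) × Bool)}

/-- **The per-configuration factor with the cut set.** For a height configuration with unit
differences at every tracked corner whose frozen turns are consistent in `cfgOf ω` iff they are
consistent for the prescribed data (Lemma C), the cut set of Part 14 is `{c | IsCut c}`:
`∏_c turnFactor h (cfgOf ω) c = 𝟙[∀ c ∉ B, bit h (σ c) = bit h c] · ∏_c exp(i ε(bit h c) g c)` with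
`g = (π/12) turnSign (cfgOf ω)` off the cuts and `0` on them. [cite: BaxterKellandWu1976, §3–§4] -/
theorem dict_prod_turnFactor_eq [DecidablePred M.IsCut] (h : ↥M.freeCells → ℤ)
    (hunit : ∀ x ∈ M.vertexCells, ∀ f ∈ SixVertex.vertexFaces x, f ∈ M.faceCells → |M.hv h x - M.hf h f| = 1)
    (hC : ∀ c, ¬M.TargetsLive c →
      (M.TurnConsistent h (M.cfgOf ω) c ↔ M.TurnConsistent (fun _ => 0) (M.cfgOf ∅) c)) :
    ∏ c ∈ cornerSet M.piece, M.turnFactor h (M.cfgOf ω) c =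
      (if ∀ c ∈ cornerSet M.piece, ¬M.IsCut c → M.bit h (nextCorner (M.cfgOf ω) c) = M.bit h c then 1 else 0) *
        ∏ c ∈ cornerSet M.piece, Complex.exp (Complex.I * (BKW.sgn (M.bit h c) : ℂ) *
          ((if M.IsCut c then (0 : ℝ) else Real.pi / 12 * (turnSign (M.cfgOf ω) c : ℝ) : ℝ) : ℂ)) := by
  classical
  have key : ∀ c ∈ cornerSet M.piece,
      (c ∈ (cornerSet M.piece).filter (fun c => ¬M.TargetsLive c ∧ ¬M.TurnConsistent h (M.cfgOf ω) c) ↔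
        M.IsCut c) := fun c hc => by
    rw [mem_filter, IsCut]
    constructor
    · rintro ⟨-, hl, ht⟩; exact ⟨hl, fun h0 => ht ((hC c hl).2 h0)⟩
    · rintro ⟨hl, ht⟩; exact ⟨hc, hl, fun h1 => ht ((hC c hl).1 h1)⟩
  rw [perCfg_prod_turnFactor_eq h (M.cfgOf ω) (cornerSet M.piece) hunit]
  congr 1
  · refine if_congr (forall₂_congr fun c hc => ?_) rfl rfl
    rw [key c hc]
  · refine prod_congr rfl fun c hc => ?_
    rw [if_congr (key c hc) rfl rfl]

/-- If the arrow bits of `h` are invariant under the turning rule off the cuts, every live turn is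
consistent (live targets are never cuts, and at a live target consistency is equality of bits). [cite: BaxterKellandWu1976, §4] -/
theorem dict_live_consistent_of_invariant (h : ↥M.freeCells → ℤ)
    (hunit : ∀ x ∈ M.vertexCells, ∀ f ∈ SixVertex.vertexFaces x, f ∈ M.faceCells → |M.hv h x - M.hf h f| = 1)
    (H : ∀ c ∈ cornerSet M.piece, ¬M.IsCut c → M.bit h (nextCorner (M.cfgOf ω) c) = M.bit h c) :
    ∀ c ∈ cornerSet M.piece, M.TargetsLive c → M.TurnConsistent h (M.cfgOf ω) c := fun c hc hl =>
  (perCfg_turnConsistent_iff_of_targetsLive hunit (M.cfgOf ω) hl).2 (H c hc fun hcut => hcut.1 hl)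

/-- **Vanishing**: if no valid height configuration has all its live turns consistent in
`cfgOf ω`, the sum over the height configurations of the products of turn factors is `0`. [cite: BaxterKellandWu1976, §3–§4] -/
theorem dict_sum_eq_zero_of_inconsistent
    (hno : ∀ h ∈ M.configs, ¬ ∀ c ∈ cornerSet M.piece, M.TargetsLive c → M.TurnConsistent h (M.cfgOf ω) c) :
    ∑ h ∈ M.configs, ∏ c ∈ cornerSet M.piece, M.turnFactor h (M.cfgOf ω) c = 0 := by
  classical
  refine sum_eq_zero fun h hh => ?_
  rw [M.prod_turnFactor_eq h (M.cfgOf ω) (cornerSet M.piece), if_neg (hno h hh)]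

end PerConfiguration

/-! ### The change of variables `h ↦ bit h` -/

section ChangeOfVariables

variable {M : CollarLegModel} {ω : Finset ((ℤ × ℤ) × Bool)}

/-- Every face at a lattice point is the face of one of the four corners at it. [folklore] -/
theorem dict_exists_corner_of_vertexFaces {x f : ℤ × ℤ} (hf : f ∈ SixVertex.vertexFaces x) :
    ∃ k : Fin 4, ofSite (cFace (toSite x, k)) = f := by
  simp only [SixVertex.vertexFaces, mem_insert, mem_singleton] at hf
  rcases hf with rfl | rfl | rfl | rfl
  · exact ⟨0, by rw [ofSite_cFace_toSite]; rfl⟩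
  · exact ⟨1, by rw [ofSite_cFace_toSite]; rfl⟩
  · exact ⟨3, by rw [ofSite_cFace_toSite]; rfl⟩
  · exact ⟨2, by rw [ofSite_cFace_toSite]; rfl⟩

/-- Two unit differences with the same arrow bit are equal. [folklore] -/
theorem dict_eq_of_abs_eq_one {a b : ℤ} (ha : |a| = 1) (hb : |b| = 1) (h : decide (a = 1) = decide (b = 1)) :
    a = b := by
  rw [abs_eq (zero_le_one' ℤ)] at ha hb
  rcases ha with rfl | rfl <;> rcases hb with rfl | rfl <;> first | rfl | exact absurd h (by decide)

/-- **Injectivity of `h ↦ bit h` on the valid configurations** (unit differences at every tracked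
corner; heights are determined by their arrows, Part 10). [cite: BaxterKellandWu1976, §3] -/
theorem dict_bit_injOn
    (hunit : ∀ h ∈ M.configs, ∀ x ∈ M.vertexCells, ∀ f ∈ SixVertex.vertexFaces x, f ∈ M.faceCells →
      |M.hv h x - M.hf h f| = 1) :
    Set.InjOn (fun (h : ↥M.freeCells → ℤ) (c : ↥(cornerSet M.piece)) => M.bit h c.1) ↑M.configs := by
  intro h₁ hh₁ h₂ hh₂ heq
  apply heights_eq_of_hdiff_eq
  intro x hx f hf hfc
  obtain ⟨k, hk⟩ := dict_exists_corner_of_vertexFaces hf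
  have hc : (toSite x, k) ∈ cornerSet M.piece := by
    rw [mem_cornerSet, piece]; exact mem_image_of_mem _ hx
  have e := congrFun heq ⟨(toSite x, k), hc⟩
  simp only [bit, ofSite_toSite, hk] at e
  exact dict_eq_of_abs_eq_one (hunit h₁ (mem_coe.1 hh₁) x hx f hf hfc) (hunit h₂ (mem_coe.1 hh₂) x hx f hf hfc) e

variable [DecidablePred M.IsCut]

/-- **The image of the change of variables.** Restricted to the valid configurations whose bits
are invariant under the turning rule off the cuts, `h ↦ bit h|_C` maps ONTO the consistent arrow
configurations with the forced bits `bit h₀` on the cuts — given the forced-bits statement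
`hforced` (bits of valid configurations agree at cut corners) and the heights-existence statement
`H5ω` (every consistent arrow assignment with the forced bits is realised). [cite: BaxterKellandWu1976, §3] -/
theorem dict_image_bit_eq (σ : Equiv.Perm ↥(cornerSet M.piece))
    (hσ : ∀ c, ((σ c : ↥(cornerSet M.piece)) : Site 2 × Fin 4) = nextCorner (M.cfgOf ω) c)
    (h₀ : ↥M.freeCells → ℤ)
    (hforced : ∀ h ∈ M.configs, ∀ c ∈ cornerSet M.piece, M.IsCut c → M.bit h c = M.bit h₀ c)
    (H5ω : ∀ s : Site 2 × Fin 4 → Bool,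
      (∀ c ∈ cornerSet M.piece, ¬M.IsCut c → s (nextCorner (M.cfgOf ω) c) = s c) →
      (∀ c ∈ cornerSet M.piece, M.IsCut c → s c = M.bit h₀ c) →
        ∃ h ∈ M.configs, ∀ c ∈ cornerSet M.piece, M.bit h c = s c) :
    (M.configs.filter (fun h => ∀ c ∈ cornerSet M.piece, ¬M.IsCut c →
        M.bit h (nextCorner (M.cfgOf ω) c) = M.bit h c)).image
        (fun (h : ↥M.freeCells → ℤ) (c : ↥(cornerSet M.piece)) => M.bit h c.1) =
      univ.filter (fun s : ↥(cornerSet M.piece) → Bool =>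
        (∀ c, c ∉ univ.filter (fun c : ↥(cornerSet M.piece) => M.IsCut c.1) → s (σ c) = s c) ∧
        ∀ c ∈ univ.filter (fun c : ↥(cornerSet M.piece) => M.IsCut c.1), s c = M.bit h₀ c.1) := by
  have hnext : ∀ c ∈ cornerSet M.piece, nextCorner (M.cfgOf ω) c ∈ cornerSet M.piece := fun c hc => by
    rw [← hσ ⟨c, hc⟩]; exact (σ ⟨c, hc⟩).2
  ext s
  simp only [mem_image, mem_filter, mem_univ, true_and]
  constructor
  · rintro ⟨h, ⟨hh, hinv⟩, rfl⟩
    refine ⟨fun c hc => ?_, fun c hc => hforced h hh c.1 c.2 hc⟩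
    show M.bit h (σ c).1 = M.bit h c.1
    rw [hσ]; exact hinv c.1 c.2 hc
  · rintro ⟨hcons, hfor⟩
    set s' : Site 2 × Fin 4 → Bool := fun c => if hc : c ∈ cornerSet M.piece then s ⟨c, hc⟩ else false with hs'
    have hs'c : ∀ c (hc : c ∈ cornerSet M.piece), s' c = s ⟨c, hc⟩ := fun c hc => dif_pos hc
    have h1 : ∀ c ∈ cornerSet M.piece, ¬M.IsCut c → s' (nextCorner (M.cfgOf ω) c) = s' c := by
      intro c hc hcut
      rw [hs'c _ (hnext c hc), hs'c c hc, ← hcons ⟨c, hc⟩ hcut]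
      congr 1; exact Subtype.ext (hσ ⟨c, hc⟩).symm
    have h2 : ∀ c ∈ cornerSet M.piece, M.IsCut c → s' c = M.bit h₀ c := fun c hc hcut => by
      rw [hs'c c hc]; exact hfor ⟨c, hc⟩ hcut
    obtain ⟨h, hh, hbit⟩ := H5ω s' h1 h2
    refine ⟨h, ⟨hh, fun c hc hcut => ?_⟩, funext fun c => ?_⟩
    · rw [hbit _ (hnext c hc), hbit c hc]; exact h1 c hc hcut
    · show M.bit h c.1 = s c
      rw [hbit c.1 c.2, hs'c c.1 c.2]

/-- **The sum over the height configurations as an abstract strand sum.** For `ω` (meant `⊆ E`),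
a permutation `σ` of the corners over the piece acting as the turning rule of `cfgOf ω`, unit
differences at every tracked corner of every valid configuration (Lemma V), the frozen consistency
transfer (Lemma C), the forced bits on the cuts and heights-existence for this `ω`:
`Σ_{h ∈ configs} ∏_c turnFactor h (cfgOf ω) c = Σ_{s consistent off B, s = bit h₀ on B} ∏_c exp(i ε(s c) g c)`,
the left-hand side of `bkwStrand_sum_consistent_forced` (Part 5) with `B` the cut corners and
`g = (π/12) turnSign (cfgOf ω)` off `B`, `0` on `B`. [cite: BaxterKellandWu1976, §3–§4] -/
theorem dict_sum_configs_eq_sum_consistent (σ : Equiv.Perm ↥(cornerSet M.piece))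
    (hσ : ∀ c, ((σ c : ↥(cornerSet M.piece)) : Site 2 × Fin 4) = nextCorner (M.cfgOf ω) c)
    (h₀ : ↥M.freeCells → ℤ)
    (hunit : ∀ h ∈ M.configs, ∀ x ∈ M.vertexCells, ∀ f ∈ SixVertex.vertexFaces x, f ∈ M.faceCells →
      |M.hv h x - M.hf h f| = 1)
    (hC : ∀ h ∈ M.configs, ∀ c, ¬M.TargetsLive c →
      (M.TurnConsistent h (M.cfgOf ω) c ↔ M.TurnConsistent (fun _ => 0) (M.cfgOf ∅) c))
    (hforced : ∀ h ∈ M.configs, ∀ c ∈ cornerSet M.piece, M.IsCut c → M.bit h c = M.bit h₀ c)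
    (H5ω : ∀ s : Site 2 × Fin 4 → Bool,
      (∀ c ∈ cornerSet M.piece, ¬M.IsCut c → s (nextCorner (M.cfgOf ω) c) = s c) →
      (∀ c ∈ cornerSet M.piece, M.IsCut c → s c = M.bit h₀ c) →
        ∃ h ∈ M.configs, ∀ c ∈ cornerSet M.piece, M.bit h c = s c) :
    ∑ h ∈ M.configs, ∏ c ∈ cornerSet M.piece, M.turnFactor h (M.cfgOf ω) c =
      ∑ s ∈ univ.filter (fun s : ↥(cornerSet M.piece) → Bool =>
          (∀ c, c ∉ univ.filter (fun c : ↥(cornerSet M.piece) => M.IsCut c.1) → s (σ c) = s c) ∧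
          ∀ c ∈ univ.filter (fun c : ↥(cornerSet M.piece) => M.IsCut c.1), s c = M.bit h₀ c.1),
        ∏ c, Complex.exp (Complex.I * (BKW.sgn (s c) : ℂ) *
          ((if M.IsCut c.1 then (0 : ℝ) else Real.pi / 12 * (turnSign (M.cfgOf ω) c.1 : ℝ) : ℝ) : ℂ)) := by
  rw [← dict_image_bit_eq σ hσ h₀ hforced H5ω,
    sum_image ((dict_bit_injOn hunit).mono (coe_subset.2 (filter_subset _ _))), sum_filter]
  refine sum_congr rfl fun h hh => ?_
  rw [dict_prod_turnFactor_eq h (hunit h hh) (hC h hh)]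
  split_ifs
  · rw [one_mul, ← prod_coe_sort (cornerSet M.piece)]
  · rw [zero_mul]

end ChangeOfVariables

/-! ### Registered sub-goal of this Part -/

/-- **Sub-goal `s17_dictionary_of_part1`** (registered on stmt-CriticalPhenomena-14132; D2 count
assembly, steps 1–2): for a collar leg model `M`, `ω ⊆ E`, a reference configuration `h₀`, unit
differences at every tracked corner of every valid configuration (Lemma V), the frozen consistency
transfer (Lemma C), forced bits on the cut corners and heights-existence for `ω`, the sum over the
valid height configurations of `∏_c turnFactor h (cfgOf ω) c` equals the sum, over the arrow
configurations `s` on the corners over the piece that are invariant under the turning rule off the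
cuts and equal to `bit h₀` on the cuts, of `∏_c exp(i ε(s c) g c)`, `g = (π/12) turnSign (cfgOf ω)` off
the cuts and `0` on them. [cite: BaxterKellandWu1976, §3–§4] -/
theorem s17_dictionary_of_part1 : ∀ (M : Literature.Probability.LatticeModels.CollarLegModel) (ω : Finset ((ℤ × ℤ) × Bool)) [DecidablePred M.IsCut] (h₀ : ↥M.freeCells → ℤ), ω ⊆ M.E → (∀ h ∈ M.configs, ∀ x ∈ M.vertexCells, ∀ f ∈ Literature.Probability.LatticeModels.SixVertex.vertexFaces x, f ∈ M.faceCells → |M.hv h x - M.hf h f| = 1) → (∀ h ∈ M.configs, ∀ c, ¬M.TargetsLive c → (M.TurnConsistent h (M.cfgOf ω) c ↔ M.TurnConsistent (fun _ => 0) (M.cfgOf ∅) c)) → (∀ h ∈ M.configs, ∀ c ∈ Literature.Probability.Percolation.cornerSet M.piece, M.IsCut c → M.bit h c = M.bit h₀ c) → (∀ s : Literature.Probability.LatticeModels.Site 2 × Fin 4 → Bool, (∀ c ∈ Literature.Probability.Percolation.cornerSet M.piece, ¬M.IsCut c → s (Literature.Probability.LatticeModels.nextCorner (M.cfgOf ω)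 c) = s c) → (∀ c ∈ Literature.Probability.Percolation.cornerSet M.piece, M.IsCut c → s c = M.bit h₀ c) → ∃ h ∈ M.configs, ∀ c ∈ Literature.Probability.Percolation.cornerSet M.piece, M.bit h c = s c) → ∑ h ∈ M.configs, ∏ c ∈ Literature.Probability.Percolation.cornerSet M.piece, M.turnFactor h (M.cfgOf ω) c = ∑ s ∈ Finset.univ.filter (fun s : ↥(Literature.Probability.Percolation.cornerSet M.piece) → Bool => (∀ c c' : ↥(Literature.Probability.Percolation.cornerSet M.piece), Literature.Probability.LatticeModels.nextCorner (M.cfgOf ω) c.1 = c'.1 → ¬M.IsCut c.1 → s c' = s c) ∧ ∀ c : ↥(Literature.Probability.Percolation.cornerSet M.piece), M.IsCut c.1 → s c = M.bit h₀ c.1), ∏ c : ↥(Literature.Probability.Percolation.cornerSet M.piece), Complex.exp (Complex.I * (Literature.Probability.Percolation.BKW.sgn (s c) : ℂ) * ((if M.IsCut c.1 then (0 : ℝ) else Real.pi / 12 * (Literature.Probability.LatticeModels.turnSign (M.cfgOf ω) c.1 : ℝ) : ℝ) : ℂ)) := by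
  intro M ω _ h₀ hω hunit hC hforced H5ω
  set σ : Equiv.Perm ↥(cornerSet M.piece) :=
    (cornerPerm (M.cfgOf ω)).subtypePerm (fun c => nextCorner_cfgOf_mem_cornerSet_iff M hω c) with hσdef
  have hσ : ∀ c, ((σ c : ↥(cornerSet M.piece)) : Site 2 × Fin 4) = nextCorner (M.cfgOf ω) c := fun c => rfl
  rw [dict_sum_configs_eq_sum_consistent σ hσ h₀ hunit hC hforced H5ω]
  congr 1
  ext s
  simp only [mem_filter, mem_univ, true_and]
  refine and_congr ⟨fun H c c' hcc' hcut => ?_, fun H c hcut => H c (σ c) (hσ c).symm hcut⟩ Iff.rfl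
  have : c' = σ c := Subtype.ext (by rw [hσ]; exact hcc'.symm)
  rw [this]; exact H c hcut

end Summit.CriticalPhenomena.CardyFormulaZ2.Cruxes.BoundaryDefectGaussianR.RainbowMonomialsInExcursionKernels
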